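import Mathlib
import Summits.ValiantsHypothesis.ValiantsHypothesis.Theorems.BarrierLeverPartitionMinorsHitByVPHiddenStatesCoStarRecursion
import Summits.ValiantsHypothesis.ValiantsHypothesis.Theorems.BarrierLeverPartitionMinorsHitByVPHiddenStatesCoStarConjecture

/-!
# Route BarrierLever — item `PartitionMinorsHitByVP` (stmt-ValiantsHypothesis-19717), line `hidden-states`:
# THE CO-STAR RECURSION, part 3/3 — THE LOWER CO-STAR THEOREM for co-size ≤ 4 (all `h`) and the node cell `r = 2^h − 4` of
# `LowerNode.Stmt.universalJoinWideLower` for EVERY `h ≥ 3`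

Helper file (`--supports stmt-ValiantsHypothesis-19717`; cell valiant-natproofs, rung V4, 𝒟-side door (c), registered line
`Cruxes/PartitionMinorsHitByVP/Lines/hidden_states.lean` v7; prover seat val-np-p6 gen 11). Definition-free; closes NO item.

* `coStarLower_exists_table` — **THE LOWER CO-STAR THEOREM (co-size `c + 1 ≤ 4`, every `h`; co-size 5 given `SatFour`).** The co-star piece
  `T_{h,c}` (ONE piece, `K = h` states: all state sets except the top and the `c` co-singletons `univ ∖ {qs j}`; a legal strict threshold family,
  `CoStar.coStar_design` p617131) has a nonsingular design matrix at some table for EVERY injective row family `u` of size `2^h − (c+1)` whose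
  range is a LOWER SET — verbatim the hypothesis `hC` of `CoStar.universalJoinWide_of_coStarAll` restricted to lower `u`. Proof: the missing rows
  of a lower family form an up-set of size `c + 1`; apply the recursion theorem `SymbJoin.coStar_subcube_symGood` (part 2/3) to the full blocks
  `Y = univ`, `Q = univ`, and pass from generic to numeric goodness (`SymbJoin.exists_table_of_symGood`).
* `universalJoinWideLower_of_coStar` — the body of `LowerNode.Stmt.universalJoinWideLower` (p599518) at `(h, 2^h − (c+1))` for every `h ≥ 1`,
  `c ≤ h`, `c ≤ 3` (resp. `c ≤ 4` given `SatFour`), with `m = 1` piece and `K = h` states.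
* **`universalJoinWideLower_top_four`** — the headline all-`h` cell: for EVERY `h ≥ 3` the lower node holds at `r = 2^h − 4` (first lower cell
  beyond the permutation-table range `c ≤ 2` of p615482/p616812, which already hold for all `u`). By the BLOCK REDUCTION of memo val-np-p6 g10
  §10 this is the kernel form of «`T_{3,3} = B₁([3])` is free»; here it falls out of the recursion with no certificate.

Census behind the conjecture column (kit, `--workitem 19717`): saturated co-star checks `0` bad for co-size `≤ 9` (j302814, j303913: h = 8, c+1 = 9,
0/11 159 up-sets), so by block reduction the co-star serves every down-set of co-size `≤ 9` at every `h` on paper; the kernel now has co-size `≤ 4`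
(this file) and `≤ 5` after `SatFour` (part 3b). WHAT THIS IS NOT: finite-`c` cells at the TOP of the range are thin (`h + 1` sizes per `h`) and
the crux is unconditional there anyway (`ProductStateSums.partitionMinor_hit_of_cosmall`); no stub of the line is closed; nothing on crux 14610 or
VP ≠ VNP.
-/

set_option linter.dupNamespace false

namespace Summit.ValiantsHypothesis.ValiantsHypothesis.Theorems.BarrierLever.HiddenStates

open Finset Matrix MvPolynomial

noncomputable section

namespace CoStar

/-! ## 1. The co-star column family is the full co-star family -/

/-- An injective enumeration of state sets avoiding `univ` and the `c` co-singletons `univ ∖ {qs j}`, of length `2^h − (c+1)`, hits every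
such set. -/
theorem coStar_cols_range {h c r : ℕ} (qs : Fin c → Fin h) (hqs : Function.Injective qs) (hr : r + (c + 1) = 2 ^ h)
    (cols : Fin r → Finset (Fin h)) (hcols : Function.Injective cols) (hcu : ∀ k, cols k ≠ Finset.univ)
    (hcq : ∀ k j, cols k ≠ Finset.univ.erase (qs j)) :
    ∀ J, (∃ k, cols k = J) ↔ J ⊆ Finset.univ ∧ J ≠ Finset.univ ∧ ∀ q ∈ Finset.univ.image qs, J ≠ Finset.univ.erase q := by
  classical
  set Q : Finset (Fin h) := Finset.univ.image qs with hQ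
  have hQc : Q.card = c := by
    rw [hQ, Finset.card_image_of_injective _ hqs, Finset.card_univ, Fintype.card_fin]
  set N : Finset (Finset (Fin h)) := insert Finset.univ (Q.image fun q => Finset.univ.erase q) with hN
  have hNcard : N.card = c + 1 := by
    rw [hN, Finset.card_insert_of_notMem, Finset.card_image_of_injOn (fun q _ q' _ hqq => Finset.erase_injOn _
      (Finset.mem_univ q) (Finset.mem_univ q') hqq), hQc]
    intro hmem
    obtain ⟨q, -, hq⟩ := Finset.mem_image.mp hmem
    have : q ∈ (Finset.univ : Finset (Fin h)).erase q := by rw [hq]; exact Finset.mem_univ q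
    exact Finset.notMem_erase q _ this
  have hmemN : ∀ J, J ∉ N ↔ J ≠ Finset.univ ∧ ∀ q ∈ Q, J ≠ Finset.univ.erase q := by
    intro J
    rw [hN, Finset.mem_insert, not_or, Finset.mem_image, not_exists]
    simp only [not_and]
    constructor
    · rintro ⟨h1, h2⟩; exact ⟨h1, fun q hq hJ => h2 q hq hJ.symm⟩
    · rintro ⟨h1, h2⟩; exact ⟨h1, fun q hq hJ => h2 q hq hJ.symm⟩
  -- the image of `cols` is `univ \ N`
  have hsub : Finset.univ.image cols ⊆ Finset.univ \ N := by
    intro J hJ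
    obtain ⟨k, -, rfl⟩ := Finset.mem_image.mp hJ
    rw [Finset.mem_sdiff, hmemN]
    refine ⟨Finset.mem_univ _, hcu k, fun q hq => ?_⟩
    obtain ⟨j, -, rfl⟩ := Finset.mem_image.mp hq
    exact hcq k j
  have heq : Finset.univ.image cols = Finset.univ \ N := by
    apply Finset.eq_of_subset_of_card_le hsub
    rw [Finset.card_sdiff_of_subset (Finset.subset_univ _), Finset.card_univ, Fintype.card_finset, Fintype.card_fin, hNcard,
      Finset.card_image_of_injective _ hcols, Finset.card_univ, Fintype.card_fin]
    omega
  intro J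
  constructor
  · rintro ⟨k, rfl⟩
    have : cols k ∈ Finset.univ \ N := hsub (Finset.mem_image_of_mem cols (Finset.mem_univ k))
    rw [Finset.mem_sdiff, hmemN] at this
    exact ⟨Finset.subset_univ _, this.2⟩
  · rintro ⟨-, hJu, hJq⟩
    have : J ∈ Finset.univ.image cols := by
      rw [heq, Finset.mem_sdiff, hmemN]
      exact ⟨Finset.mem_univ _, hJu, hJq⟩
    obtain ⟨k, -, hk⟩ := Finset.mem_image.mp this
    exact ⟨k, hk⟩

/-! ## 2. The lower co-star theorem -/

/-- **THE LOWER CO-STAR THEOREM.** For `c ≤ 3` — or `c ≤ 4` given `SatFour` (an up-closed family of `5` subsets of a `4`-block has a coordinate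
avoided by exactly one member) — the co-star `T_{h,c}` serves EVERY injective LOWER row family of size `2^h − (c+1)`, for every `h`. -/
theorem coStarLower_exists_table (h c r m : ℕ) (p₀ : Fin m)
    (hc : c ≤ 3 ∨ (c ≤ 4 ∧ ∀ (Y : Finset (Fin h)) (𝒜 : Finset (Finset (Fin h))), Y.card = 4 →
      (∀ A ∈ 𝒜, A ⊆ Y) → (∀ A ∈ 𝒜, ∀ A', A ⊆ A' → A' ⊆ Y → A' ∈ 𝒜) → 𝒜.card = 5 →
      ∃ x ∈ Y, (𝒜.filter fun A => x ∉ A).card = 1))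
    (qs : Fin c → Fin h) (hqs : Function.Injective qs) (hr : r + (c + 1) = 2 ^ h)
    (cols : Fin r → Finset (Fin h)) (hcols : Function.Injective cols) (hcu : ∀ k, cols k ≠ Finset.univ)
    (hcq : ∀ k j, cols k ≠ Finset.univ.erase (qs j))
    (u : Fin r → Finset (Fin h)) (hu : Function.Injective u) (hlow : IsLowerSet (Set.range u)) :
    ∃ tx : Fin m → Option (Fin h) → Fin h → ℂ,
      (Matrix.of fun i k : Fin r =>
        ∏ x ∈ u i, (tx p₀ none x + ∑ q ∈ cols k, tx p₀ (some q) x)).det ≠ 0 := by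
  classical
  -- the missing rows: an up-set of size `c + 1`
  set 𝒜 : Finset (Finset (Fin h)) := Finset.univ \ Finset.univ.image u with h𝒜
  have h𝒜card : 𝒜.card = (Finset.univ.image qs).card + 1 := by
    rw [h𝒜, Finset.card_sdiff_of_subset (Finset.subset_univ _), Finset.card_univ, Fintype.card_finset, Fintype.card_fin,
      Finset.card_image_of_injective _ hu, Finset.card_univ, Fintype.card_fin, Finset.card_image_of_injective _ hqs,
      Finset.card_univ, Fintype.card_fin]
    omega
  have hrows : ∀ S, (∃ i, u i = S) ↔ S ⊆ Finset.univ ∧ S ∉ 𝒜 := by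
    intro S
    rw [h𝒜, Finset.mem_sdiff, not_and, not_not, Finset.mem_image]
    constructor
    · rintro ⟨i, rfl⟩; exact ⟨Finset.subset_univ _, fun _ => ⟨i, Finset.mem_univ _, rfl⟩⟩
    · rintro ⟨-, hS⟩; obtain ⟨i, -, hi⟩ := hS (Finset.mem_univ _); exact ⟨i, hi⟩
  have hup : ∀ A ∈ 𝒜, ∀ A', A ⊆ A' → A' ⊆ Finset.univ → A' ∈ 𝒜 := by
    intro A hA A' hAA' _
    rw [h𝒜, Finset.mem_sdiff] at hA ⊢
    refine ⟨Finset.mem_univ _, fun hA' => hA.2 ?_⟩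
    obtain ⟨i, -, rfl⟩ := Finset.mem_image.mp hA'
    obtain ⟨j, hj⟩ := hlow hAA' ⟨i, rfl⟩
    exact Finset.mem_image.mpr ⟨j, Finset.mem_univ _, hj⟩
  -- the recursion theorem, for the full blocks
  have hcmax : c ≤ 3 ∨ (c = 4 ∧ ∀ (Y : Finset (Fin h)) (𝒜 : Finset (Finset (Fin h))), Y.card = 4 →
      (∀ A ∈ 𝒜, A ⊆ Y) → (∀ A ∈ 𝒜, ∀ A', A ⊆ A' → A' ⊆ Y → A' ∈ 𝒜) → 𝒜.card = 5 →
      ∃ x ∈ Y, (𝒜.filter fun A => x ∉ A).card = 1) := by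
    rcases hc with hc | ⟨hc4, H⟩
    · exact Or.inl hc
    · by_cases hc3 : c ≤ 3
      · exact Or.inl hc3
      · exact Or.inr ⟨by omega, H⟩
  have hG := SymbJoin.coStar_subcube_symGood (n := h) (K := h) p₀ c hcmax h Finset.univ Finset.univ (Finset.univ.image qs) 𝒜 r
    u cols (by rw [Finset.card_univ, Fintype.card_fin]) (by rw [Finset.card_univ, Fintype.card_fin]) (Finset.subset_univ _)
    (by rw [Finset.card_image_of_injective _ hqs, Finset.card_univ, Fintype.card_fin])
    (fun A _ => Finset.subset_univ A) hup h𝒜card hu hrows hcols (coStar_cols_range qs hqs hr cols hcols hcu hcq)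
  exact SymbJoin.exists_table_of_symGood u (fun k => (p₀, cols k)) hG

/-! ## 3. The node cells -/

/-- **The lower node at `r = 2^h − (c+1)` from the lower co-star theorem** (`h ≥ 1`, `c ≤ h`, `c ≤ 3` or `c ≤ 4 ∧ SatFour`): the body of
`LowerNode.Stmt.universalJoinWideLower` with ONE piece and `K = h` states. -/
theorem universalJoinWideLower_of_coStar (h c r : ℕ) (h1 : 1 ≤ h) (hch : c ≤ h)
    (hc : c ≤ 3 ∨ (c ≤ 4 ∧ ∀ (Y : Finset (Fin h)) (𝒜 : Finset (Finset (Fin h))), Y.card = 4 →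
      (∀ A ∈ 𝒜, A ⊆ Y) → (∀ A ∈ 𝒜, ∀ A', A ⊆ A' → A' ⊆ Y → A' ∈ 𝒜) → 𝒜.card = 5 →
      ∃ x ∈ Y, (𝒜.filter fun A => x ∉ A).card = 1))
    (hr : r + (c + 1) = 2 ^ h) :
    ∃ (m K : ℕ) (W : Fin m → ℕ) (wt : Fin m → Fin K → ℕ) (e : Fin r → Fin m × Finset (Fin K)),
      m ≤ h + h ∧ K ≤ h * h * h ∧ Function.Injective e ∧
      (∀ x : Fin m × Finset (Fin K), x ∉ Set.range e →
        ∀ i, W (e i).1 + ∑ k ∈ (e i).2, wt (e i).1 k < W x.1 + ∑ k ∈ x.2, wt x.1 k) ∧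
      ∀ u : Fin r → Finset (Fin h), Function.Injective u → IsLowerSet (Set.range u) →
        ∃ tx : Fin m → Option (Fin K) → Fin h → ℂ,
          (Matrix.of fun i k : Fin r =>
            ∏ a ∈ u i, (tx (e k).1 none a + ∑ q ∈ (e k).2, tx (e k).1 (some q) a)).det ≠ 0 := by
  classical
  let qs : Fin c → Fin h := fun j => Fin.castLE hch j
  have hqs : Function.Injective qs := fun j j' hjj => Fin.castLE_injective hch hjj
  obtain ⟨cols, hcols, hcu, hcq, hthr⟩ := coStar_design h c r h1 qs hqs hr
  refine ⟨1, h, fun _ => 0, fun _ q => if q ∈ Finset.univ.image qs then 1 else 2, fun k => ((0 : Fin 1), cols k), by omega,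
    le_trans (Nat.le_mul_of_pos_right h h1) (Nat.le_mul_of_pos_right _ h1), ?_, hthr, ?_⟩
  · intro k k' hkk
    exact hcols (congrArg Prod.snd hkk)
  · intro u hu hlow
    exact coStarLower_exists_table h c r 1 (0 : Fin 1) hc qs hqs hr cols hcols hcu hcq u hu hlow

/-- **THE LOWER NODE AT `r = 2^h − 4` FOR EVERY `h ≥ 3`** (one co-star piece with three special states). -/
theorem universalJoinWideLower_top_four (h : ℕ) (h3 : 3 ≤ h) :
    ∃ (m K : ℕ) (W : Fin m → ℕ) (wt : Fin m → Fin K → ℕ) (e : Fin (2 ^ h - 4) → Fin m × Finset (Fin K)),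
      m ≤ h + h ∧ K ≤ h * h * h ∧ Function.Injective e ∧
      (∀ x : Fin m × Finset (Fin K), x ∉ Set.range e →
        ∀ i, W (e i).1 + ∑ k ∈ (e i).2, wt (e i).1 k < W x.1 + ∑ k ∈ x.2, wt x.1 k) ∧
      ∀ u : Fin (2 ^ h - 4) → Finset (Fin h), Function.Injective u → IsLowerSet (Set.range u) →
        ∃ tx : Fin m → Option (Fin K) → Fin h → ℂ,
          (Matrix.of fun i k : Fin (2 ^ h - 4) =>
            ∏ a ∈ u i, (tx (e k).1 none a + ∑ q ∈ (e k).2, tx (e k).1 (some q) a)).det ≠ 0 := by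
  have h8 : 8 ≤ 2 ^ h := by
    calc 8 = 2 ^ 3 := by norm_num
      _ ≤ 2 ^ h := Nat.pow_le_pow_right (by norm_num) h3
  exact universalJoinWideLower_of_coStar h 3 (2 ^ h - 4) (by omega) h3 (Or.inl le_rfl) (by omega)

/-- The lower node at the top FOUR sizes `r = 2^h − (c+1)`, `c ≤ 3`, of every `h ≥ 3` (uniform statement; `c ≤ 2` were already cells for ALL
row families: p614189, p616281, p616812). -/
theorem universalJoinWideLower_top_le_four (h c : ℕ) (h3 : 3 ≤ h) (hc : c ≤ 3) :
    ∃ (m K : ℕ) (W : Fin m → ℕ) (wt : Fin m → Fin K → ℕ) (e : Fin (2 ^ h - (c + 1)) → Fin m × Finset (Fin K)),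
      m ≤ h + h ∧ K ≤ h * h * h ∧ Function.Injective e ∧
      (∀ x : Fin m × Finset (Fin K), x ∉ Set.range e →
        ∀ i, W (e i).1 + ∑ k ∈ (e i).2, wt (e i).1 k < W x.1 + ∑ k ∈ x.2, wt x.1 k) ∧
      ∀ u : Fin (2 ^ h - (c + 1)) → Finset (Fin h), Function.Injective u → IsLowerSet (Set.range u) →
        ∃ tx : Fin m → Option (Fin K) → Fin h → ℂ,
          (Matrix.of fun i k : Fin (2 ^ h - (c + 1)) =>
            ∏ a ∈ u i, (tx (e k).1 none a + ∑ q ∈ (e k).2, tx (e k).1 (some q) a)).det ≠ 0 := by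
  have h8 : 8 ≤ 2 ^ h := by
    calc 8 = 2 ^ 3 := by norm_num
      _ ≤ 2 ^ h := Nat.pow_le_pow_right (by norm_num) h3
  exact universalJoinWideLower_of_coStar h c (2 ^ h - (c + 1)) (by omega) (by omega) (Or.inl hc) (by omega)

end CoStar

end

end Summit.ValiantsHypothesis.ValiantsHypothesis.Theorems.BarrierLever.HiddenStates
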